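import Summits.Ventures.PercRepro.C025ProfileStarRule
import Summits.Ventures.PercRepro.C025ProfileFourRuleEDem
/-!
# THE RULE `E*_u` — `(Dem)` BY CONSTRUCTION (night-3 g11)
`proofs/NIGHT3-G11-ESTAR.md`. The families of `C025ProfileStarRule` are non-empty whenever the rule needs them, in rank
`≥ u + 1`: `G_B` always (`Gfam_nonempty`: `B ∪ F_B` spans, so `F_B` contains `u − 2` points independent over `B` —
the EXTENSION LEMMA `exists_subset_card_eRk_add`), `Ls_B` with `G_B` when the line of `B` has a third point, and
`P_B` when a pair whose line has no third point has a positive deficit (`Pfam_nonempty_of_defic_pos`: then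
`|G_B| < C(p, u−2) ≤ C(|F_B|, u−2)`, so some `(u−2)`-subset `Y` of `F_B` is dependent over `B`; a basis `W` of `Y`
over `B` is extended inside `F_B ∖ Y` to rank `u` and one point of `Y ∖ W` is put back — a `(u−1)`-set of rank `u`).
Hence **`dem_wEstar`**: every rank-`2` set receives at least its price, by the uniform spreading of the residual.
-/
open scoped Matroid
namespace PercRepro
open Set Finset ThmH
namespace EStar
variable {α : Type} [DecidableEq α] {M : Matroid α} [M.Finite] {u : ℕ}

/-- **The extension lemma**: if `ρ(X ∪ Z) ≥ ρ(X) + m`, some `m` points of `Z` raise the rank of `X` by exactly `m`. -/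
theorem exists_subset_card_eRk_add {X Z : Finset α} (hX : X ⊆ gr M) (hZ : Z ⊆ gr M) (m : ℕ)
    (h : M.eRk (X : Set α) + (m : ℕ∞) ≤ M.eRk ((X ∪ Z : Finset α) : Set α)) :
    ∃ W ⊆ Z, W.card = m ∧ M.eRk ((X ∪ W : Finset α) : Set α) = M.eRk (X : Set α) + (m : ℕ∞) := by
  induction m with
  | zero => exact ⟨∅, Finset.empty_subset _, Finset.card_empty, by rw [Finset.union_empty, Nat.cast_zero, add_zero]⟩
  | succ m ih =>
    have hfin : M.eRk (X : Set α) ≠ ⊤ := (M.isRkFinite_set _).eRk_lt_top.ne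
    have hm : M.eRk (X : Set α) + (m : ℕ∞) ≤ M.eRk ((X ∪ Z : Finset α) : Set α) := by
      refine le_trans ?_ h
      exact add_le_add (le_refl _) (by exact_mod_cast Nat.le_succ m)
    obtain ⟨W, hWZ, hWc, hWr⟩ := ih hm
    have hXW : X ∪ W ⊆ gr M := Finset.union_subset hX (hWZ.trans hZ)
    have hlt : M.eRk ((X ∪ W : Finset α) : Set α) < M.eRk ((X ∪ W ∪ Z : Finset α) : Set α) := by
      rw [hWr]
      refine lt_of_lt_of_le ?_ (h.trans (M.eRk_mono ?_))
      · rw [Nat.cast_succ]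
        exact (ENat.add_lt_add_iff_left hfin).2 (by
          have : (m : ℕ∞) + 1 = ((m + 1 : ℕ) : ℕ∞) := by push_cast; rfl
          rw [this]; exact_mod_cast Nat.lt_succ_self m)
      · intro x hx
        rw [Finset.mem_coe, Finset.mem_union] at hx ⊢
        rcases hx with hx | hx
        · exact Or.inl (Finset.mem_union_left _ hx)
        · exact Or.inr hx
    obtain ⟨z, hzZ, hzcl⟩ := exists_mem_notMem_closure_of_eRk_lt hXW hlt
    have hzE : z ∈ M.E := by rw [← coe_gr]; exact_mod_cast hZ hzZ
    have hzW : z ∉ W := fun hzW => hzcl (M.subset_closure _ (by rw [← coe_gr]; exact_mod_cast hXW)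
      (by rw [Finset.mem_coe]; exact Finset.mem_union_right _ hzW))
    refine ⟨insert z W, Finset.insert_subset hzZ hWZ, by rw [Finset.card_insert_of_notMem hzW, hWc], ?_⟩
    have heq : X ∪ insert z W = insert z (X ∪ W) := by
      ext y; simp only [Finset.mem_union, Finset.mem_insert]; tauto
    rw [heq, Finset.coe_insert, Matroid.eRk_insert_eq_add_one ⟨hzE, hzcl⟩, hWr, Nat.cast_succ, add_assoc]

/-- **`G_B` is non-empty in rank `≥ u + 1`**: `F_B` contains `u − 2` points independent over `B`. -/
theorem Gfam_nonempty (hR : (u : ℕ∞) + 1 ≤ M.eRank) (hu : 2 ≤ u) {B : Finset α} (hB : B ∈ Profile.Rq M 2) :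
    (Gfam M u B).Nonempty := by
  obtain ⟨hBg, hB2⟩ := Profile.mem_Rq.1 hB
  have hspan := (eRank_le_eRk_union_Fs hBg).trans' hR
  have hcast : ((2 : ℕ) : ℕ∞) + ((u - 2 : ℕ) : ℕ∞) = (u : ℕ∞) := by
    rw [← Nat.cast_add]; congr 1; omega
  obtain ⟨W, hWF, hWc, hWr⟩ := exists_subset_card_eRk_add hBg (Fs_subset_gr B) (u - 2) (by
    rw [hB2, hcast]; exact le_trans (le_add_right le_rfl) hspan)
  exact ⟨W, mem_Gfam.2 ⟨hWF, hWc, by rw [hWr, hB2, hcast]⟩⟩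

/-- `Ls_B` is non-empty when the line of `B` has a third point and `G_B` is non-empty. -/
theorem Lfam_nonempty {B : Finset α} (ht : 1 ≤ (clF M B \ B).card) (hG : (Gfam M u B).Nonempty) :
    (Lfam M u B).Nonempty := by
  obtain ⟨x, hx⟩ := Finset.card_pos.1 ht
  obtain ⟨Y, hY⟩ := hG
  exact ⟨insert x Y, mem_Lfam.2 ⟨x, hx, Y, hY, rfl⟩⟩

/-- The price of the row `(2,u)` vanishes below the threshold. -/
theorem price_eq_zero_of_lt {B : Finset α} (h : crk M B < u) : Profile.price M 2 u B = 0 := by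
  unfold Profile.price
  rw [if_neg]
  rw [eRk_gr_sdiff_eq_crk]
  exact not_le.2 (by exact_mod_cast h)

/-- At or above the threshold, `price(B) · C(u,2) = C(p, u−2)` with `p = ρ(E∖B)`. -/
theorem price_mul_choose_eq {B : Finset α} (hu : 2 ≤ u) (h : u ≤ crk M B) :
    Profile.price M 2 u B * (Nat.choose u 2 : ℚ) = (Nat.choose (crk M B) (u - 2) : ℚ) := by
  unfold Profile.price
  rw [eRk_gr_sdiff_eq_crk, ENat.toNat_coe, if_pos (by exact_mod_cast h)]
  have hmul := Nat.choose_mul (n := crk M B + 2) (k := u) (s := 2) hu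
  rw [Nat.add_sub_cancel] at hmul
  have hpos : (0 : ℚ) < (Nat.choose (crk M B + 2) 2 : ℚ) := by exact_mod_cast Nat.choose_pos (by omega)
  field_simp
  exact_mod_cast hmul

/-- A positive deficit of an active pair means `|G_B| < C(p, u−2)`. -/
theorem card_Gfam_lt_choose_of_defic_pos {B : Finset α} (hu : 2 ≤ u) (h : u ≤ crk M B)
    (hd : 0 < defic M u B) : (Gfam M u B).card < Nat.choose (crk M B) (u - 2) := by
  unfold defic gsh at hd
  have hcpos := cap_pos hu
  have hpm := price_mul_choose_eq (M := M) hu h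
  have hchoose : (0 : ℚ) < (Nat.choose u 2 : ℚ) := by exact_mod_cast Nat.choose_pos hu
  by_cases h0 : (Gfam M u B).card = 0
  · rw [h0]; exact Nat.choose_pos (by omega)
  have hNpos : (0 : ℚ) < ((Gfam M u B).card : ℚ) := by exact_mod_cast Nat.pos_of_ne_zero h0
  rcases min_choice (cap u) (Profile.price M 2 u B / ((Gfam M u B).card : ℚ)) with hmin | hmin
  · rw [hmin] at hd
    -- `N · cap < price`, i.e. `N < price · C(u,2) = C(p, u−2)`
    have h1 : ((Gfam M u B).card : ℚ) * cap u < Profile.price M 2 u B := by linarith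
    unfold cap at h1
    have h2 : ((Gfam M u B).card : ℚ) < Profile.price M 2 u B * (Nat.choose u 2 : ℚ) := by
      rw [mul_one_div] at h1
      rwa [div_lt_iff₀ hchoose] at h1
    rw [hpm] at h2
    exact_mod_cast h2
  · rw [hmin, mul_div_cancel₀ _ hNpos.ne', sub_self] at hd
    exact absurd hd (lt_irrefl 0)

/-- **`P_B` is non-empty when a pair whose line has no third point has a positive deficit** (rank `≥ u + 1`). -/
theorem Pfam_nonempty_of_defic_pos (hR : (u : ℕ∞) + 1 ≤ M.eRank) (hu : 3 ≤ u) {B : Finset α}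
    (hB : B ∈ Profile.Rq M 2) (ht : (clF M B \ B).card = 0) (hd : 0 < defic M u B) :
    (Pfam M u B).Nonempty := by
  obtain ⟨hBg, hB2⟩ := Profile.mem_Rq.1 hB
  have hcl : clF M B = B := by
    have := Finset.card_eq_zero.1 ht
    rw [Finset.sdiff_eq_empty_iff_subset] at this
    exact le_antisymm this (subset_clF_self hBg)
  have hFs : Fs M B = gr M \ B := by unfold Fs; rw [hcl]
  have hp : u ≤ crk M B := by
    by_contra h
    push Not at h
    unfold defic at hd
    rw [price_eq_zero_of_lt h] at hd
    have : (0 : ℚ) ≤ ((Gfam M u B).card : ℚ) * gsh M u B := by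
      exact mul_nonneg (Nat.cast_nonneg _) (gsh_nonneg B)
    linarith
  have hGlt := card_Gfam_lt_choose_of_defic_pos (by omega) hp hd
  -- `p ≤ |F_B|`
  have hpF : crk M B ≤ (Fs M B).card := by
    have h1 : M.eRk ((Fs M B : Finset α) : Set α) = (crk M B : ℕ∞) := by rw [hFs, eRk_gr_sdiff_eq_crk]
    have h2 := M.eRk_le_encard ((Fs M B : Finset α) : Set α)
    rw [h1, Set.encard_coe_eq_coe_finsetCard] at h2
    exact_mod_cast h2
  have hcard : Nat.choose (crk M B) (u - 2) ≤ ((Fs M B).powersetCard (u - 2)).card := by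
    rw [Finset.card_powersetCard]; exact Nat.choose_le_choose _ hpF
  -- a dependent `(u−2)`-subset `Y` of `F_B`
  obtain ⟨Y, hYp, hYu⟩ : ∃ Y ∈ (Fs M B).powersetCard (u - 2), M.eRk ((B ∪ Y : Finset α) : Set α) ≠ (u : ℕ∞) := by
    by_contra h
    push Not at h
    have : Gfam M u B = (Fs M B).powersetCard (u - 2) := by
      unfold Gfam; exact Finset.filter_true_of_mem h
    rw [this] at hGlt
    omega
  rw [Finset.mem_powersetCard] at hYp
  have hYg : Y ⊆ gr M := hYp.1.trans (Fs_subset_gr B)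
  have hBYg : B ∪ Y ⊆ gr M := Finset.union_subset hBg hYg
  -- `2 ≤ ρ(B ∪ Y) ≤ u`, hence `ρ(B ∪ Y) = j` with `2 ≤ j < u`
  have hfinBY : M.eRk ((B ∪ Y : Finset α) : Set α) ≠ ⊤ := (M.isRkFinite_set _).eRk_lt_top.ne
  obtain ⟨j, hj⟩ := ENat.ne_top_iff_exists.1 hfinBY
  have hjle : j ≤ u := by
    have h1 : M.eRk ((B ∪ Y : Finset α) : Set α) ≤ (u : ℕ∞) := by
      rw [Finset.coe_union]
      refine (M.eRk_union_le_eRk_add_eRk _ _).trans ?_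
      rw [hB2]
      have : M.eRk (Y : Set α) ≤ ((u - 2 : ℕ) : ℕ∞) := by
        refine (M.eRk_le_encard _).trans ?_
        rw [Set.encard_coe_eq_coe_finsetCard, hYp.2]
      calc ((2 : ℕ) : ℕ∞) + M.eRk (Y : Set α) ≤ ((2 : ℕ) : ℕ∞) + ((u - 2 : ℕ) : ℕ∞) :=
            add_le_add (le_refl _) this
        _ = (u : ℕ∞) := by rw [← Nat.cast_add]; congr 1; omega
    rw [← hj] at h1
    exact_mod_cast h1
  have hjne : j ≠ u := by rintro rfl; exact hYu hj.symm
  have hjge : 2 ≤ j := by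
    have h1 : M.eRk (B : Set α) ≤ M.eRk ((B ∪ Y : Finset α) : Set α) := M.eRk_mono (by
      rw [Finset.coe_union]; exact Set.subset_union_left)
    rw [hB2, ← hj] at h1
    exact_mod_cast h1
  -- a basis `W` of `Y` over `B`
  have hcastj : ((2 : ℕ) : ℕ∞) + ((j - 2 : ℕ) : ℕ∞) = (j : ℕ∞) := by
    rw [← Nat.cast_add]; congr 1; omega
  obtain ⟨W, hWY, hWc, hWr⟩ := exists_subset_card_eRk_add hBg hYg (j - 2) (by rw [hB2, hcastj, hj])
  rw [hB2, hcastj] at hWr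
  have hBWg : B ∪ W ⊆ gr M := Finset.union_subset hBg (hWY.trans hYg)
  -- `Y ⊆ cl (B ∪ W)`
  have hYcl : (Y : Set α) ⊆ M.closure ((B ∪ W : Finset α) : Set α) := by
    intro y hy
    by_contra hycl
    have hyE : y ∈ M.E := by rw [← coe_gr]; exact_mod_cast hYg hy
    have h1 : M.eRk ((insert y (B ∪ W) : Finset α) : Set α) = (j : ℕ∞) + 1 := by
      rw [Finset.coe_insert, Matroid.eRk_insert_eq_add_one ⟨hyE, hycl⟩, hWr]
    have h2 : M.eRk ((insert y (B ∪ W) : Finset α) : Set α) ≤ M.eRk ((B ∪ Y : Finset α) : Set α) := by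
      apply M.eRk_mono
      intro x hx
      rw [Finset.mem_coe, Finset.mem_insert, Finset.mem_union] at hx
      rw [Finset.mem_coe, Finset.mem_union]
      rcases hx with rfl | hx | hx
      · exact Or.inr hy
      · exact Or.inl hx
      · exact Or.inr (hWY hx)
    rw [h1, ← hj] at h2
    have h3 : (j : ℕ∞) + 1 = ((j + 1 : ℕ) : ℕ∞) := by push_cast; rfl
    rw [h3] at h2
    have : j + 1 ≤ j := by exact_mod_cast h2
    omega
  -- `B ∪ W ∪ (F_B ∖ Y)` spans (its closure contains `B ∪ F_B`)
  have hspan : (u : ℕ∞) + 1 ≤ M.eRk ((B ∪ W ∪ (Fs M B \ Y) : Finset α) : Set α) := by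
    refine ((eRank_le_eRk_union_Fs hBg).trans' hR).trans ?_
    rw [← M.eRk_closure_eq ((B ∪ W ∪ (Fs M B \ Y) : Finset α) : Set α)]
    apply M.eRk_mono
    have hsub : ((B ∪ W ∪ (Fs M B \ Y) : Finset α) : Set α) ⊆ M.E := by
      rw [← coe_gr]
      exact_mod_cast Finset.union_subset hBWg (Finset.sdiff_subset.trans (Fs_subset_gr B))
    intro x hx
    rw [Finset.mem_coe, Finset.mem_union] at hx
    by_cases hxY : x ∈ Y
    · exact M.closure_subset_closure (Finset.coe_subset.2 Finset.subset_union_left) (hYcl hxY)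
    · apply M.subset_closure _ hsub
      rw [Finset.mem_coe, Finset.mem_union]
      rcases hx with hx | hx
      · exact Or.inl (Finset.mem_union_left _ hx)
      · exact Or.inr (Finset.mem_sdiff.2 ⟨hx, hxY⟩)
  have hcastu : (j : ℕ∞) + ((u - j : ℕ) : ℕ∞) = (u : ℕ∞) := by
    rw [← Nat.cast_add]; congr 1; omega
  obtain ⟨W', hW'F, hW'c, hW'r⟩ := exists_subset_card_eRk_add hBWg (Finset.sdiff_subset.trans (Fs_subset_gr B))
    (u - j) (by rw [hWr, hcastu]; exact le_trans (le_add_right le_rfl) hspan)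
  rw [hWr, hcastu] at hW'r
  -- a point of `Y` outside `W`
  obtain ⟨y, hyY, hyW⟩ := Finset.exists_mem_notMem_of_card_lt_card (s := W) (t := Y) (by rw [hWc, hYp.2]; omega)
  have hyW' : y ∉ W' := fun h => (Finset.mem_sdiff.1 (hW'F h)).2 hyY
  have hdisj : Disjoint W W' := by
    rw [Finset.disjoint_left]
    intro x hxW hxW'
    exact (Finset.mem_sdiff.1 (hW'F hxW')).2 (hWY hxW)
  have hyWW' : y ∉ W ∪ W' := by rw [Finset.mem_union]; tauto
  refine ⟨insert y (W ∪ W'), mem_Pfam.2 ⟨?_, ?_, ?_⟩⟩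
  · exact Finset.insert_subset (hYp.1 hyY) (Finset.union_subset (hWY.trans hYp.1) (hW'F.trans Finset.sdiff_subset))
  · rw [Finset.card_insert_of_notMem hyWW', Finset.card_union_of_disjoint hdisj, hWc, hW'c]; omega
  · have hycl : y ∈ M.closure ((B ∪ W ∪ W' : Finset α) : Set α) :=
      M.closure_subset_closure (Finset.coe_subset.2 Finset.subset_union_left) (hYcl hyY)
    have heq : B ∪ insert y (W ∪ W') = insert y (B ∪ W ∪ W') := by
      ext x; simp only [Finset.mem_union, Finset.mem_insert]; tauto
    rw [heq, eRk_insert_eq_of_mem_closure (Finset.union_subset hBWg (hW'F.trans (Finset.sdiff_subset.trans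
      (Fs_subset_gr B)))) hycl, hW'r]

/-- `recv(B) ≥ 0`. -/
theorem recv_nonneg (B : Finset α) : 0 ≤ recv M u B :=
  Finset.sum_nonneg (fun _ _ => mul_nonneg (req_nonneg B) (grant_nonneg _))

/-- The sets of `G_B ∪ P_B` are disjoint from `B` and give rank-`u` supersets. -/
theorem family_G_or_P {B : Finset α} (hBg : B ⊆ gr M) :
    ∀ Z ∈ Gfam M u B ∪ Pfam M u B, Disjoint B Z ∧ B ∪ Z ∈ Shadow.levelSet M u := by
  intro Z hZ
  rw [Finset.mem_union] at hZ
  rcases hZ with hZ | hZ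
  · exact disjoint_and_level_of_mem_Gfam hBg hZ
  · exact disjoint_and_level_of_mem_Pfam hBg hZ

/-- The sets of `G_B ∪ Ls_B` are disjoint from `B` and give rank-`u` supersets. -/
theorem family_G_or_L {B : Finset α} (hBg : B ⊆ gr M) :
    ∀ Z ∈ Gfam M u B ∪ Lfam M u B, Disjoint B Z ∧ B ∪ Z ∈ Shadow.levelSet M u := by
  intro Z hZ
  rw [Finset.mem_union] at hZ
  rcases hZ with hZ | hZ
  · exact disjoint_and_level_of_mem_Gfam hBg hZ
  · exact disjoint_and_level_of_mem_Lfam hBg hZ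

/-- The generic part of a pair sums to `|G_B|·g_B + recv(B)` over the good sets. -/
theorem sum_generic_eq {B : Finset α} :
    ∑ Y ∈ Gfam M u B, (gsh M u B + req M u B * grant M u (B ∪ Y)) =
      ((Gfam M u B).card : ℚ) * gsh M u B + recv M u B := by
  unfold recv
  rw [Finset.sum_add_distrib, Finset.sum_const, nsmul_eq_mul]

/-- **`(Dem)` for rule `E*_u`, by construction**: every rank-`2` set receives at least its price from the rank-`u`
sets containing it (rank `≥ u + 1`, `u ≥ 3`). -/
theorem dem_wEstar (hR : (u : ℕ∞) + 1 ≤ M.eRank) (hu : 3 ≤ u) {B : Finset α} (hB : B ∈ Profile.Rq M 2) :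
    Profile.price M 2 u B ≤ ∑ S ∈ (Shadow.levelSet M u).filter (fun S => B ⊆ S), wEstar M u B S := by
  obtain ⟨hBg, _⟩ := Profile.mem_Rq.1 hB
  have hG := Gfam_nonempty hR (by omega) hB
  by_cases hp : crk M B < u
  · rw [price_eq_zero_of_lt hp]
    exact Finset.sum_nonneg (fun S _ => wEstar_nonneg B S)
  push Not at hp
  have hdef : Profile.price M 2 u B = ((Gfam M u B).card : ℚ) * gsh M u B + defic M u B := by
    unfold defic; ring
  have hres : defic M u B = recv M u B + resid M u B := by unfold resid; ring
  by_cases hc : B.card = 2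
  · by_cases ht : 1 ≤ (clF M B \ B).card
    · -- the residual goes to `Ls_B`
      refine le_trans ?_ (sum_levelSet_ge_sum_family (wEstar M u B) (wEstar_nonneg B) (Gfam M u B ∪ Lfam M u B)
        (family_G_or_L hBg))
      have hval : ∀ Z ∈ Gfam M u B ∪ Lfam M u B, wEstar M u B (B ∪ Z) =
          (if Z ∈ Gfam M u B then gsh M u B + req M u B * grant M u (B ∪ Z) else 0) +
          (if Z ∈ Lfam M u B then resid M u B / ((Lfam M u B).card : ℚ) else 0) := by
        intro Z hZ
        unfold wEstar
        rw [union_sdiff_self_eq (family_G_or_L hBg Z hZ).1, if_neg (not_lt.2 hp), if_pos hc, if_pos ht]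
      rw [Finset.sum_congr rfl hval, Finset.sum_add_distrib, Finset.sum_ite_mem, Finset.sum_ite_mem,
        Finset.inter_eq_right.2 Finset.subset_union_left, Finset.inter_eq_right.2 Finset.subset_union_right,
        sum_generic_eq, Finset.sum_const, nsmul_eq_mul, card_mul_div_card (Lfam_nonempty ht hG)]
      linarith
    · -- the residual goes to `P_B`
      have ht0 : (clF M B \ B).card = 0 := by omega
      refine le_trans ?_ (sum_levelSet_ge_sum_family (wEstar M u B) (wEstar_nonneg B) (Gfam M u B ∪ Pfam M u B)
        (family_G_or_P hBg))
      have hval : ∀ Z ∈ Gfam M u B ∪ Pfam M u B, wEstar M u B (B ∪ Z) =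
          (if Z ∈ Gfam M u B then gsh M u B + req M u B * grant M u (B ∪ Z) else 0) +
          (if Z ∈ Pfam M u B then resid M u B / ((Pfam M u B).card : ℚ) else 0) := by
        intro Z hZ
        unfold wEstar
        rw [union_sdiff_self_eq (family_G_or_P hBg Z hZ).1, if_neg (not_lt.2 hp), if_pos hc, if_neg ht]
      rw [Finset.sum_congr rfl hval, Finset.sum_add_distrib, Finset.sum_ite_mem, Finset.sum_ite_mem,
        Finset.inter_eq_right.2 Finset.subset_union_left, Finset.inter_eq_right.2 Finset.subset_union_right,
        sum_generic_eq, Finset.sum_const, nsmul_eq_mul]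
      have hP : ((Pfam M u B).card : ℚ) * (resid M u B / ((Pfam M u B).card : ℚ)) = resid M u B := by
        by_cases hPe : (Pfam M u B).Nonempty
        · exact card_mul_div_card hPe _
        · have hd0 : resid M u B = 0 := by
            by_contra hne
            have hrpos : 0 < resid M u B := lt_of_le_of_ne (resid_nonneg B) (Ne.symm hne)
            have hdpos : 0 < defic M u B := by linarith [recv_nonneg (M := M) (u := u) B, hres]
            exact hPe (Pfam_nonempty_of_defic_pos hR hu hB ht0 hdpos)
          rw [hd0, zero_div, mul_zero]
      rw [hP]
      linarith
  · -- fat `B`: the price is spread over `G_B ∪ P_B`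
    refine le_trans ?_ (sum_levelSet_ge_sum_family (wEstar M u B) (wEstar_nonneg B) (Gfam M u B ∪ Pfam M u B)
      (family_G_or_P hBg))
    have hval : ∀ Z ∈ Gfam M u B ∪ Pfam M u B, wEstar M u B (B ∪ Z) =
        Profile.price M 2 u B / (((Gfam M u B ∪ Pfam M u B).card : ℚ)) := by
      intro Z hZ
      unfold wEstar
      rw [union_sdiff_self_eq (family_G_or_P hBg Z hZ).1, if_neg (not_lt.2 hp), if_neg hc, if_pos hZ]
    rw [Finset.sum_congr rfl hval, Finset.sum_const, nsmul_eq_mul,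
      card_mul_div_card (hG.mono Finset.subset_union_left)]

end EStar
end PercRepro
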